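import Literature.MathematicalPhysics.QuantumFieldTheory.Balaban1983to89.InfiniteVolumeSufficientIII
import HarnessLib

/-!
# Robust ball (Y2), area-law side — THE STRONG-COUPLING FREE-ENERGY LAW, II: a Fatou lemma on a coupling interval

HONEST FRAMING: venture file of the cell `pub-ymgap` (QuantumFields programme), track ROBUST-BALL, seat rb-p2 (g7).  Pure real
analysis (Mathlib only; the Literature import is for the build graph): the limit exchange used by the free-energy law
(`FreeEnergyLaw.lean`) to pass POINTWISE eventual bounds on the coupling derivative of the torus pressures to the limiting
free energy density.  Nothing lattice-specific, nothing continuum / Clay.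

WHAT IS PROVED (everything, no definitions):
* ★ `le_integral_of_forall_eventually_le` — if `h L : ℝ → ℝ` are continuous, `≤ C` on `[0, β]`, `∫₀^β h L → g`, and at every
  `s ∈ [0, β]`, for every `ε > 0`, eventually `h L s ≤ U s + ε` (`U` continuous, `≤ C`), then `g ≤ ∫₀^β U` — Fatou's lemma
  (Mathlib `lintegral_liminf_le'`) for the non-negative functions `C − h L`;
* `integral_le_of_forall_eventually_ge` — the lower twin (apply the former to `−h L`);
* `integral_mul_exp_le`, `le_integral_mul_exp_neg` — `∫₀^β a s e^{±c s} ds` against `a e^{±cβ} β²/2`.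

Everything here is proved. [folklore]
-/

noncomputable section

open MeasureTheory Filter Topology

namespace Summit.Ventures.YMGap.RobustBall

namespace FreeEnergyLaw

/-! ### A Fatou lemma on a coupling interval -/

section Fatou

/-- **Fatou on a coupling interval, upper form.**  Let `h L : ℝ → ℝ` be continuous, bounded above by `C` on `[0, β]`, with
`∫₀^β h L → g`; if at every `s ∈ [0, β]` and for every `ε > 0` eventually `h L s ≤ U s + ε` (`U` continuous on `[0, β]`,
`U ≤ C` there), then `g ≤ ∫₀^β U` (Fatou's lemma for the non-negative functions `C − h L`, Mathlib `lintegral_liminf_le'`).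
[folklore] -/
theorem le_integral_of_forall_eventually_le {h : ℕ → ℝ → ℝ} {U : ℝ → ℝ} {β g C : ℝ} (hβ : 0 ≤ β)
    (hcont : ∀ L, Continuous (h L)) (hU : ContinuousOn U (Set.Icc 0 β))
    (hhC : ∀ L, ∀ s ∈ Set.Icc 0 β, h L s ≤ C) (hUC : ∀ s ∈ Set.Icc 0 β, U s ≤ C)
    (hev : ∀ s ∈ Set.Icc 0 β, ∀ ε : ℝ, 0 < ε → ∀ᶠ L : ℕ in atTop, h L s ≤ U s + ε)
    (hlim : Tendsto (fun L => ∫ s in (0 : ℝ)..β, h L s) atTop (𝓝 g)) :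
    g ≤ ∫ s in (0 : ℝ)..β, U s := by
  haveI : IsFiniteMeasure ((volume : Measure ℝ).restrict (Set.Ioc 0 β)) := inferInstance
  have hνβ : ((volume : Measure ℝ).restrict (Set.Ioc 0 β)).real Set.univ = β := by
    rw [measureReal_restrict_apply_univ, Real.volume_real_Ioc_of_le hβ, sub_zero]
  have hUi : Integrable U ((volume : Measure ℝ).restrict (Set.Ioc 0 β)) :=
    (hU.integrableOn_Icc).mono_set Set.Ioc_subset_Icc_self
  have hhi : ∀ L, Integrable (h L) ((volume : Measure ℝ).restrict (Set.Ioc 0 β)) := fun L =>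
    ((hcont L).continuousOn.integrableOn_Icc).mono_set Set.Ioc_subset_Icc_self
  have hk_meas : ∀ L, Measurable fun s => ENNReal.ofReal (C - h L s) := fun L =>
    ENNReal.measurable_ofReal.comp (measurable_const.sub (hcont L).measurable)
  -- the Lebesgue integrals of `C − h L`
  have hk : ∀ L, ∫⁻ s, ENNReal.ofReal (C - h L s) ∂((volume : Measure ℝ).restrict (Set.Ioc 0 β)) =
      ENNReal.ofReal (C * β - ∫ s in (0 : ℝ)..β, h L s) := by
    intro L
    have hnn : 0 ≤ᵐ[(volume : Measure ℝ).restrict (Set.Ioc 0 β)] fun s => C - h L s :=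
      (ae_restrict_iff' measurableSet_Ioc).2 (ae_of_all _ fun s hs =>
        sub_nonneg.2 (hhC L s (Set.Ioc_subset_Icc_self hs)))
    rw [← ofReal_integral_eq_lintegral_ofReal (f := fun s => C - h L s) ((integrable_const C).sub (hhi L)) hnn,
      integral_sub (integrable_const C) (hhi L), integral_const, smul_eq_mul, hνβ,
      intervalIntegral.integral_of_le hβ, mul_comm]
  -- the Lebesgue integral of `C − U`
  have hkU : ∫⁻ s, ENNReal.ofReal (C - U s) ∂((volume : Measure ℝ).restrict (Set.Ioc 0 β)) =
      ENNReal.ofReal (C * β - ∫ s in (0 : ℝ)..β, U s) := by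
    have hnn : 0 ≤ᵐ[(volume : Measure ℝ).restrict (Set.Ioc 0 β)] fun s => C - U s :=
      (ae_restrict_iff' measurableSet_Ioc).2 (ae_of_all _ fun s hs =>
        sub_nonneg.2 (hUC s (Set.Ioc_subset_Icc_self hs)))
    rw [← ofReal_integral_eq_lintegral_ofReal (f := fun s => C - U s) ((integrable_const C).sub hUi) hnn,
      integral_sub (integrable_const C) hUi, integral_const, smul_eq_mul, hνβ,
      intervalIntegral.integral_of_le hβ, mul_comm]
  -- pointwise: `ofReal (C − U s) ≤ liminf_L ofReal (C − h L s)` on `(0, β]`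
  have hpt : ∀ s ∈ Set.Ioc 0 β, ENNReal.ofReal (C - U s) ≤
      liminf (fun L => ENNReal.ofReal (C - h L s)) atTop := by
    intro s hs
    have hs' : s ∈ Set.Icc 0 β := Set.Ioc_subset_Icc_self hs
    refine ENNReal.le_of_forall_pos_le_add fun ε hε _ => ?_
    have hevε : ∀ᶠ L : ℕ in atTop, ENNReal.ofReal (C - U s - ε) ≤ ENNReal.ofReal (C - h L s) :=
      (hev s hs' ε (by exact_mod_cast hε)).mono fun L hL => ENNReal.ofReal_le_ofReal (by linarith)
    calc ENNReal.ofReal (C - U s) = ENNReal.ofReal ((C - U s - ε) + ε) := by ring_nf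
      _ ≤ ENNReal.ofReal (C - U s - ε) + ENNReal.ofReal ε := ENNReal.ofReal_add_le
      _ ≤ liminf (fun L => ENNReal.ofReal (C - h L s)) atTop + ε := by
          rw [ENNReal.ofReal_coe_nnreal]
          exact add_le_add (le_liminf_of_le (h := hevε)) le_rfl
  -- Fatou
  have hfatou := lintegral_liminf_le' (μ := (volume : Measure ℝ).restrict (Set.Ioc 0 β))
    (f := fun (L : ℕ) (s : ℝ) => ENNReal.ofReal (C - h L s)) (u := atTop) fun L => (hk_meas L).aemeasurable
  have hmono : ∫⁻ s, ENNReal.ofReal (C - U s) ∂((volume : Measure ℝ).restrict (Set.Ioc 0 β)) ≤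
      ∫⁻ s, liminf (fun L => ENNReal.ofReal (C - h L s)) atTop ∂((volume : Measure ℝ).restrict (Set.Ioc 0 β)) :=
    lintegral_mono_ae ((ae_restrict_iff' measurableSet_Ioc).2 (ae_of_all _ fun s hs => hpt s hs))
  -- the right-hand side converges
  have hconv : Tendsto (fun L : ℕ => ∫⁻ s, ENNReal.ofReal (C - h L s) ∂((volume : Measure ℝ).restrict (Set.Ioc 0 β)))
      atTop (𝓝 (ENNReal.ofReal (C * β - g))) := by
    simp only [hk]
    exact (ENNReal.continuous_ofReal.tendsto _).comp (tendsto_const_nhds.sub hlim)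
  rw [hconv.liminf_eq] at hfatou
  have hfin := (hmono.trans hfatou)
  rw [hkU] at hfin
  -- `g ≤ C β`
  have hgle : g ≤ C * β := by
    refine le_of_tendsto hlim (Eventually.of_forall fun L => ?_)
    rw [intervalIntegral.integral_of_le hβ]
    calc ∫ s in Set.Ioc 0 β, h L s ≤ ∫ s in Set.Ioc 0 β, C :=
          integral_mono_ae (hhi L) (integrable_const C)
            ((ae_restrict_iff' measurableSet_Ioc).2 (ae_of_all _ fun s hs => hhC L s (Set.Ioc_subset_Icc_self hs)))
      _ = C * β := by rw [integral_const, smul_eq_mul, hνβ, mul_comm]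
  have := (ENNReal.ofReal_le_ofReal_iff (by linarith)).1 hfin
  linarith

/-- **Fatou on a coupling interval, lower form**: if `−C ≤ h L` on `[0, β]`, `∫₀^β h L → g`, and at every `s ∈ [0, β]`
eventually `Lo s − ε ≤ h L s` (`Lo` continuous, `−C ≤ Lo` on `[0, β]`), then `∫₀^β Lo ≤ g` (the upper form for `−h L`).
[folklore] -/
theorem integral_le_of_forall_eventually_ge {h : ℕ → ℝ → ℝ} {Lo : ℝ → ℝ} {β g C : ℝ} (hβ : 0 ≤ β)
    (hcont : ∀ L, Continuous (h L)) (hLo : ContinuousOn Lo (Set.Icc 0 β))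
    (hhC : ∀ L, ∀ s ∈ Set.Icc 0 β, -C ≤ h L s) (hLoC : ∀ s ∈ Set.Icc 0 β, -C ≤ Lo s)
    (hev : ∀ s ∈ Set.Icc 0 β, ∀ ε : ℝ, 0 < ε → ∀ᶠ L : ℕ in atTop, Lo s - ε ≤ h L s)
    (hlim : Tendsto (fun L => ∫ s in (0 : ℝ)..β, h L s) atTop (𝓝 g)) :
    ∫ s in (0 : ℝ)..β, Lo s ≤ g := by
  have h' := le_integral_of_forall_eventually_le (h := fun L s => -h L s) (U := fun s => -Lo s) (g := -g) (C := C) hβ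
    (fun L => (hcont L).neg) hLo.neg (fun L s hs => by linarith [hhC L s hs]) (fun s hs => by linarith [hLoC s hs])
    (fun s hs ε hε => (hev s hs ε hε).mono fun L hL => by linarith)
    (by simp only [intervalIntegral.integral_neg]; exact hlim.neg)
  rw [intervalIntegral.integral_neg] at h'
  linarith

end Fatou

/-! ### Elementary coupling integrals -/

section Integrals

/-- `∫₀^β a s e^{c s} ds ≤ a e^{c β} β²/2` for `a, c, β ≥ 0`. [folklore] -/
theorem integral_mul_exp_le {a c β : ℝ} (ha : 0 ≤ a) (hc : 0 ≤ c) (hβ : 0 ≤ β) :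
    ∫ s in (0 : ℝ)..β, a * s * Real.exp (c * s) ≤ a * Real.exp (c * β) * β ^ 2 / 2 := by
  have h1 : ∫ s in (0 : ℝ)..β, a * s * Real.exp (c * s) ≤ ∫ s in (0 : ℝ)..β, a * Real.exp (c * β) * s := by
    refine intervalIntegral.integral_mono_on hβ ?_ ?_ fun s hs => ?_
    · exact ((continuous_const.mul continuous_id).mul (Real.continuous_exp.comp (continuous_const.mul continuous_id))).intervalIntegrable _ _
    · exact (continuous_const.mul continuous_id).intervalIntegrable _ _
    · have hs0 : 0 ≤ s := hs.1
      have hexp : Real.exp (c * s) ≤ Real.exp (c * β) := Real.exp_le_exp.2 (mul_le_mul_of_nonneg_left hs.2 hc)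
      calc a * s * Real.exp (c * s) ≤ a * s * Real.exp (c * β) := mul_le_mul_of_nonneg_left hexp (mul_nonneg ha hs0)
        _ = a * Real.exp (c * β) * s := by ring
  refine h1.trans (le_of_eq ?_)
  rw [intervalIntegral.integral_const_mul, integral_id]
  ring

/-- `a e^{−c β} β²/2 ≤ ∫₀^β a s e^{−c s} ds` for `a, c, β ≥ 0`. [folklore] -/
theorem le_integral_mul_exp_neg {a c β : ℝ} (ha : 0 ≤ a) (hc : 0 ≤ c) (hβ : 0 ≤ β) :
    a * Real.exp (-(c * β)) * β ^ 2 / 2 ≤ ∫ s in (0 : ℝ)..β, a * s * Real.exp (-(c * s)) := by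
  have h1 : ∫ s in (0 : ℝ)..β, a * Real.exp (-(c * β)) * s ≤ ∫ s in (0 : ℝ)..β, a * s * Real.exp (-(c * s)) := by
    refine intervalIntegral.integral_mono_on hβ ?_ ?_ fun s hs => ?_
    · exact (continuous_const.mul continuous_id).intervalIntegrable _ _
    · exact ((continuous_const.mul continuous_id).mul
        (Real.continuous_exp.comp (continuous_const.mul continuous_id).neg)).intervalIntegrable _ _
    · have hs0 : 0 ≤ s := hs.1
      have hexp : Real.exp (-(c * β)) ≤ Real.exp (-(c * s)) :=
        Real.exp_le_exp.2 (neg_le_neg (mul_le_mul_of_nonneg_left hs.2 hc))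
      calc a * Real.exp (-(c * β)) * s = a * s * Real.exp (-(c * β)) := by ring
        _ ≤ a * s * Real.exp (-(c * s)) := mul_le_mul_of_nonneg_left hexp (mul_nonneg ha hs0)
  refine le_trans (le_of_eq ?_) h1
  rw [intervalIntegral.integral_const_mul, integral_id]
  ring

end Integrals

end FreeEnergyLaw

end Summit.Ventures.YMGap.RobustBall
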